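import Summits.KontsevichZagierPeriods.KontsevichZagierPeriods.Theorems.LinRedNormalFormArrangementNormalFormStubRebaseSimplePosOneFibreApex

/-!
# Stub `stub_rebaseSimplePos`, part `rebaseSimplePos_oneFibre` (crux `ArrangementNormalForm`,
line `janus-bands`, v6.2) — sub-part `Assembly`

Assembly of the uniformly closed cases of the one-fibre rebase over a base of dimension
`B + 1 ≥ 1` and isolation of its RESIDUE. For a lettered band above its letter `0` with transverse
bounds `u < v` (the hypothesis `hH` of `rebaseSimplePos_oneFibre_of_above`): if the `y`-slopes of
`u` and `v` differ, the apex level `κ := u − A (v − u)`, `A = u_y/(v_y − u_y)`, is `y`-free and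
`u − κ = A (v − u)`, `v − κ = (A + 1)(v − u)`; then
`A < −1`: `rebaseSimplePos_belowApex`; `−1 < A < 0`: `rebaseSimplePos_levelSplit` at `κ`;
`A > 0`: cut the base cell by the signs of `κ` and of `v − 2κ` (rule 1a):
`{κ > 0, v < 2κ}` is `rebaseSimplePos_aboveApexNear`. What is left — the three RESIDUAL
HYPOTHESES of `RebasePos.good_above_of_residual` / `rebaseSimplePos_oneFibre_of_residual`
(registered) — is:
* `Hpar`  — PARALLEL transverse bounds (`u_y = v_y`);
* `Hthick` — band above its apex level with the apex level BELOW the letter (`κ < 0 < u < v`);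
* `Hfar`  — band above its apex level `κ > 0`, FAR regime `v ≥ 2κ`.
None of the three is dominated uniformly in `x'` (wedge mass `≍ log²` against band mass `≍ log`
near the common zeros of `κ` and `v − u`; `Hpar` contains
`[{0<x<1, 0<y<1, y+1<t<y+1+x}, 1/(x(x+1)(y+1)t)]`, which needs partial fractions in `x` and a
re-selection of the distinguished base coordinate); they are the analytic core of the stub.

References: M. Kontsevich, D. Zagier, *Periods* (2001), §1.2.
-/

noncomputable section

open Set MeasureTheory MvPolynomial
open Literature.NumberTheory.Transcendental Literature.ModelTheory.ExponentialFields

namespace Summit.KontsevichZagierPeriods.ArrangementNormalForm.JanusBands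

namespace RebasePos

open SeparatePos

section Assembly

variable {B m m' : ℕ} (L : Fin m → (Fin B → ℚ) × ℚ) (e : Fin m → ℕ) (ℓ₁ ℓ₂ : (Fin B → ℚ) × ℚ)
  (n₁ n₂ : ℕ)

/-- **A band above its letter, from the three residual hypotheses.** See the module docstring. -/
theorem good_above_of_residual (s : KZ.IntegralRep (B + 1 + 1)) (M : Fin m' → (Fin (B + 1) → ℚ) × ℚ)
    (p : MvPolynomial (Fin B) ℚ) (u v : (Fin (B + 1) → ℚ) × ℚ) (h12 : n₁ = 0 ∨ n₂ = 0)
    (hbd : Bornology.IsBounded s.domain)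
    (hdom : s.domain = gDom B 1 m' M (fun _ => Sum.inr u) (fun _ => Sum.inr v))
    (hint : EqOn s.integrand (glit B 1 p L e ℓ₁ ℓ₂ n₁ n₂ (fun _ => some 0)) s.domain)
    (hu : u.1 (Fin.last B) ≠ 0) (hv : v.1 (Fin.last B) ≠ 0)
    (hcell : ∀ z : Fin (B + 1 + 1) → ℝ, (∀ j, 0 < affF B 1 (M j) z) →
      0 < affF B 1 u z ∧ affF B 1 u z < affF B 1 v z)
    (Hpar : ∀ (m' : ℕ) (s : KZ.IntegralRep (B + 1 + 1)) (M : Fin m' → (Fin (B + 1) → ℚ) × ℚ)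
      (p : MvPolynomial (Fin B) ℚ) (u v : (Fin (B + 1) → ℚ) × ℚ), Bornology.IsBounded s.domain →
      s.domain = gDom B 1 m' M (fun _ => Sum.inr u) (fun _ => Sum.inr v) →
      EqOn s.integrand (glit B 1 p L e ℓ₁ ℓ₂ n₁ n₂ (fun _ => some 0)) s.domain →
      u.1 (Fin.last B) ≠ 0 → u.1 (Fin.last B) = v.1 (Fin.last B) →
      (∀ z : Fin (B + 1 + 1) → ℝ, (∀ j, 0 < affF B 1 (M j) z) → 0 < affF B 1 u z ∧ affF B 1 u z < affF B 1 v z) →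
      ∃ c ∈ AddSubgroup.closure (GGset B 2 1), KZ.of s - c ∈ KZ.relations)
    (Hthick : ∀ (m' : ℕ) (s : KZ.IntegralRep (B + 1 + 1)) (M : Fin m' → (Fin (B + 1) → ℚ) × ℚ)
      (p : MvPolynomial (Fin B) ℚ) (u v κ : (Fin (B + 1) → ℚ) × ℚ) (A : ℚ), Bornology.IsBounded s.domain →
      s.domain = gDom B 1 m' M (fun _ => Sum.inr u) (fun _ => Sum.inr v) →
      EqOn s.integrand (glit B 1 p L e ℓ₁ ℓ₂ n₁ n₂ (fun _ => some 0)) s.domain →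
      κ.1 (Fin.last B) = 0 → u - κ = A • (v - u) → 0 < A →
      (∀ z : Fin (B + 1 + 1) → ℝ, (∀ j, 0 < affF B 1 (M j) z) →
        affF B 1 κ z < 0 ∧ 0 < affF B 1 u z ∧ affF B 1 u z < affF B 1 v z) →
      ∃ c ∈ AddSubgroup.closure (GGset B 2 1), KZ.of s - c ∈ KZ.relations)
    (Hfar : ∀ (m' : ℕ) (s : KZ.IntegralRep (B + 1 + 1)) (M : Fin m' → (Fin (B + 1) → ℚ) × ℚ)
      (p : MvPolynomial (Fin B) ℚ) (u v κ : (Fin (B + 1) → ℚ) × ℚ) (A : ℚ), Bornology.IsBounded s.domain →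
      s.domain = gDom B 1 m' M (fun _ => Sum.inr u) (fun _ => Sum.inr v) →
      EqOn s.integrand (glit B 1 p L e ℓ₁ ℓ₂ n₁ n₂ (fun _ => some 0)) s.domain →
      κ.1 (Fin.last B) = 0 → u - κ = A • (v - u) → 0 < A →
      (∀ z : Fin (B + 1 + 1) → ℝ, (∀ j, 0 < affF B 1 (M j) z) →
        0 < affF B 1 κ z ∧ affF B 1 u z < affF B 1 v z ∧ 2 * affF B 1 κ z ≤ affF B 1 v z) →
      ∃ c ∈ AddSubgroup.closure (GGset B 2 1), KZ.of s - c ∈ KZ.relations) :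
    ∃ c ∈ AddSubgroup.closure (GGset B 2 1), KZ.of s - c ∈ KZ.relations := by
  by_cases hpar : u.1 (Fin.last B) = v.1 (Fin.last B)
  · exact Hpar m' s M p u v hbd hdom hint hu hpar hcell
  -- the apex level
  set A' : ℚ := u.1 (Fin.last B) with hA'
  set B' : ℚ := v.1 (Fin.last B) with hB'
  have hBA : B' - A' ≠ 0 := sub_ne_zero.2 (Ne.symm hpar)
  set A : ℚ := A' / (B' - A') with hAdef
  set κ : (Fin (B + 1) → ℚ) × ℚ := u - A • (v - u) with hκdef
  have hκ : κ.1 (Fin.last B) = 0 := by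
    simp only [hκdef, Prod.fst_sub, Prod.smul_fst, Pi.sub_apply, Pi.smul_apply, smul_eq_mul, hAdef]
    rw [← hA', ← hB']
    field_simp
    ring
  have hA : u - κ = A • (v - u) := by rw [hκdef, sub_sub_cancel]
  have hA1 : A ≠ -1 := fun h => by
    have : A' = -(B' - A') := by
      rw [hAdef] at h
      field_simp at h
      linarith
    exact hv (show B' = 0 by linarith)
  have hA0 : A ≠ 0 := fun h => by
    rw [hAdef, div_eq_zero_iff] at h
    exact h.elim hu hBA
  have huκ : ∀ z : Fin (B + 1 + 1) → ℝ, affF B 1 u z - affF B 1 κ z =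
      (A : ℝ) * (affF B 1 v z - affF B 1 u z) := fun z => by
    have key := congrArg (fun q => affF B 1 q z) hA
    simp only [affF_sub'', affF_smul'] at key
    exact key
  rcases lt_trichotomy A (-1) with hlt | heq | hgt
  · -- below the apex
    exact good_belowApex L e ℓ₁ ℓ₂ n₁ n₂ s M p u v κ A h12 hbd hdom hint hκ hA (by linarith) hcell
  · exact absurd heq hA1
  rcases lt_trichotomy A 0 with hlt0 | heq0 | hgt0
  · -- the apex level separates the bounds
    have hlt' : (A : ℝ) < 0 := by exact_mod_cast hlt0
    have hgt' : (-1 : ℝ) < A := by exact_mod_cast hgt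
    refine good_levelSplit (fun _ => some 0) (fun _ => u) (fun _ => v) s M L e p ℓ₁ ℓ₂
      (fun _ => Sum.inr u) (fun _ => Sum.inr v) h12 hbd hdom hint (fun _ => rfl) (fun _ => rfl) 0 κ
      (fun i c hi _ => absurd (Subsingleton.elim i 0) hi) (fun c hc => by cases hc; simpa using hκ)
      fun z hz => ?_
    have h1 := huκ z
    have h2 := (hcell z hz).2
    constructor <;> nlinarith
  · exact absurd heq0 hA0
  -- above the apex (`A > 0`)
  by_cases hκ0 : κ = 0
  · -- apex on the letter: coaxial blow-up
    exact good_coaxial 0 s M L e p ℓ₁ ℓ₂ n₁ n₂ u v A h12 hbd hdom hint (by rw [sub_zero, ← hA, hκ0, sub_zero])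
      fun z hz => (hcell z hz).2
  -- cut by the sign of `κ`
  obtain ⟨s₁, s₂, hm₁, hm₂, hi₁, hi₂, hd₁, hd₂, hrel⟩ := cutBase s M _ _ hdom κ hκ0
  have hsub₁ : s₁.domain ⊆ s.domain := fun z hz => ((hm₁ z).1 hz).1
  have hsub₂ : s₂.domain ⊆ s.domain := fun z hz => ((hm₂ z).1 hz).1
  refine good_of_split hrel ?_ ?_
  · -- `κ > 0`: cut by the sign of `v - 2κ`
    have hne : v - (2 : ℚ) • κ ≠ 0 := ne_zero_of_last (by
      simp only [Prod.fst_sub, Prod.smul_fst, Pi.sub_apply, Pi.smul_apply, smul_eq_mul, hκ,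
        mul_zero, sub_zero]
      exact hv)
    obtain ⟨s₃, s₄, hm₃, hm₄, hi₃, hi₄, hd₃, hd₄, hrel'⟩ := cutBase s₁ (Fin.snoc M κ) _ _ hd₁ _ hne
    have hsub₃ : s₃.domain ⊆ s.domain := fun z hz => hsub₁ ((hm₃ z).1 hz).1
    have hsub₄ : s₄.domain ⊆ s.domain := fun z hz => hsub₁ ((hm₄ z).1 hz).1
    have h2κ : ∀ z : Fin (B + 1 + 1) → ℝ, affF B 1 (v - (2 : ℚ) • κ) z = affF B 1 v z - 2 * affF B 1 κ z :=
      fun z => by rw [affF_sub'', affF_smul']; push_cast; ring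
    refine good_of_split hrel' ?_ ?_
    · -- far regime: residual hypothesis
      refine Hfar _ s₃ _ p u v κ A (hbd.subset hsub₃) hd₃ (by rw [hi₃, hi₁]; exact hint.mono hsub₃)
        hκ hA hgt0 fun z hz => ?_
      obtain ⟨hz', hfar⟩ := rows_snoc hz
      obtain ⟨hz'', hκpos⟩ := rows_snoc hz'
      rw [h2κ] at hfar
      exact ⟨hκpos, (hcell z hz'').2, by linarith⟩
    · -- near regime
      refine good_aboveApexNear L e ℓ₁ ℓ₂ n₁ n₂ s₄ _ p u v κ A 2 h12 (hbd.subset hsub₄) hd₄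
        (by rw [hi₄, hi₁]; exact hint.mono hsub₄) hκ hA hgt0.le fun z hz => ?_
      obtain ⟨hz', hnear⟩ := rows_snoc hz
      obtain ⟨hz'', hκpos⟩ := rows_snoc hz'
      rw [affF_neg', h2κ] at hnear
      exact ⟨hκpos, (hcell z hz'').2, by linarith⟩
  · -- `κ < 0`: residual hypothesis
    refine Hthick _ s₂ _ p u v κ A (hbd.subset hsub₂) hd₂ (by rw [hi₂]; exact hint.mono hsub₂)
      hκ hA hgt0 fun z hz => ?_
    obtain ⟨hz', hneg⟩ := rows_snoc hz
    rw [affF_neg'] at hneg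
    exact ⟨by linarith, hcell z hz'⟩

end Assembly

end RebasePos

/-- **Registered part of `stub_rebaseSimplePos` / `rebaseSimplePos_oneFibre` (line `janus-bands`,
v6.2): the one-fibre rebase from the three residual hypotheses.** For literal one-fibre data over
a base of dimension `B + 1` (any bounds, any letter, `n₁ = 0 ∨ n₂ = 0`): IF parallel transverse
bands (`Hpar`), bands above their apex level with the apex level below the letter (`Hthick`), and
bands above their apex level `κ > 0` in the far regime `v ≥ 2κ` (`Hfar`) are congruent to the
subgroup generated by `GG B 2 1`, THEN so is `[s]`: `rebaseSimplePos_oneFibre_of_above` +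
`RebasePos.good_above_of_residual` (level split, blow-up of a coaxial pinch, Janus extensions with
dominated wedges; rules 1a, 2; uniformly in `x'`). -/
theorem rebaseSimplePos_oneFibre_of_residual (B m m' n₁ n₂ : ℕ) (s : KZ.IntegralRep (B + 1 + 1)) (M : Fin m' → (Fin (B + 1) → ℚ) × ℚ) (L : Fin m → (Fin B → ℚ) × ℚ) (e : Fin m → ℕ) (p : MvPolynomial (Fin B) ℚ) (ℓ₁ ℓ₂ : (Fin B → ℚ) × ℚ) (a : Fin 1 → Option ((Fin (B + 1) → ℚ) × ℚ)) (lo hi : Fin 1 → Fin 1 ⊕ ((Fin (B + 1) → ℚ) × ℚ)) (h12 : n₁ = 0 ∨ n₂ = 0) (hbd : Bornology.IsBounded s.domain) (hdom : s.domain = SeparatePos.gDom B 1 m' M lo hi) (hint : EqOn s.integrand (RebasePos.glit B 1 p L e ℓ₁ ℓ₂ n₁ n₂ a) s.domain) (Hpar : ∀ (m' : ℕ) (s : KZ.IntegralRep (B + 1 + 1)) (M : Fin m' → (Fin (B + 1) → ℚ) × ℚ) (p : MvPolynomial (Fin B) ℚ) (u v : (Fin (B + 1) → ℚ) × ℚ),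 Bornology.IsBounded s.domain → s.domain = SeparatePos.gDom B 1 m' M (fun _ => Sum.inr u) (fun _ => Sum.inr v) → EqOn s.integrand (RebasePos.glit B 1 p L e ℓ₁ ℓ₂ n₁ n₂ (fun _ => some 0)) s.domain → u.1 (Fin.last B) ≠ 0 → u.1 (Fin.last B) = v.1 (Fin.last B) → (∀ z : Fin (B + 1 + 1) → ℝ, (∀ j, 0 < SeparatePos.affF B 1 (M j) z) → 0 < SeparatePos.affF B 1 u z ∧ SeparatePos.affF B 1 u z < SeparatePos.affF B 1 v z) → ∃ c ∈ AddSubgroup.closure (SeparatePos.GGset B 2 1), KZ.of s - c ∈ KZ.relations) (Hthick : ∀ (m' : ℕ) (s : KZ.IntegralRep (B + 1 + 1)) (M : Fin m' → (Fin (B + 1) → ℚ) × ℚ) (p : MvPolynomial (Fin B) ℚ) (u v κ : (Fin (B + 1) → ℚ) × ℚ) (A : ℚ), Bornology.IsBounded s.domain → s.domain = SeparatePos.gDom B 1 m' M (fun _ => Sum.inr u) (fun _ => Sum.inr v) → EqOn s.integrand (RebasePos.glit B 1 p L e ℓ₁ ℓ₂ n₁ n₂ (fun _ => some 0)) s.domain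 → κ.1 (Fin.last B) = 0 → u - κ = A • (v - u) → 0 < A → (∀ z : Fin (B + 1 + 1) → ℝ, (∀ j, 0 < SeparatePos.affF B 1 (M j) z) → SeparatePos.affF B 1 κ z < 0 ∧ 0 < SeparatePos.affF B 1 u z ∧ SeparatePos.affF B 1 u z < SeparatePos.affF B 1 v z) → ∃ c ∈ AddSubgroup.closure (SeparatePos.GGset B 2 1), KZ.of s - c ∈ KZ.relations) (Hfar : ∀ (m' : ℕ) (s : KZ.IntegralRep (B + 1 + 1)) (M : Fin m' → (Fin (B + 1) → ℚ) × ℚ) (p : MvPolynomial (Fin B) ℚ) (u v κ : (Fin (B + 1) → ℚ) × ℚ) (A : ℚ), Bornology.IsBounded s.domain → s.domain = SeparatePos.gDom B 1 m' M (fun _ => Sum.inr u) (fun _ => Sum.inr v) → EqOn s.integrand (RebasePos.glit B 1 p L e ℓ₁ ℓ₂ n₁ n₂ (fun _ => some 0)) s.domain → κ.1 (Fin.last B) = 0 → u - κ = A • (v - u) → 0 < A → (∀ z : Fin (B + 1 + 1) → ℝ, (∀ j, 0 < SeparatePos.affF B 1 (M j) z) → 0 < SeparatePos.affF B 1 κ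 z ∧ SeparatePos.affF B 1 u z < SeparatePos.affF B 1 v z ∧ 2 * SeparatePos.affF B 1 κ z ≤ SeparatePos.affF B 1 v z) → ∃ c ∈ AddSubgroup.closure (SeparatePos.GGset B 2 1), KZ.of s - c ∈ KZ.relations) : ∃ c ∈ AddSubgroup.closure (SeparatePos.GGset B 2 1), KZ.of s - c ∈ KZ.relations :=
  RebasePos.good_oneFibre L e ℓ₁ ℓ₂ n₁ n₂ s M p a lo hi h12 hbd hdom hint
    fun _ s M p u v hbd hdom hint hu hv hcell =>
      RebasePos.good_above_of_residual L e ℓ₁ ℓ₂ n₁ n₂ s M p u v h12 hbd hdom hint hu hv hcell Hpar Hthick Hfar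


/-- **The registered part `rebaseSimplePos_oneFibre` of `stub_rebaseSimplePos` from its three
residual hypotheses** (exactly its signature plus `Hpar`, `Hthick`, `Hfar` at `B = b + 1`,
`n₁ = 0`, `n₂ = 1`): `GS (b+1) 1 → closure (GG (b+1) 2 1)` modulo `KZ.relations`. This is what is
proved of the part; the three hypotheses are its open analytic core (see the module docstring). -/
theorem rebaseSimplePos_oneFibre_of_residual' (GS : ℕ → ℕ → Set KZ.FormalRep) (GG : ℕ → ℕ → ℕ → Set KZ.FormalRep) (hGS : ∀ b k, GS b k = {w : KZ.FormalRep | ∃ (m m' n₁ n₂ : ℕ) (s : KZ.IntegralRep (b + 1 + k)) (M : Fin m' → (Fin (b + 1) → ℚ) × ℚ) (L : Fin m → (Fin b → ℚ) × ℚ) (e : Fin m → ℕ) (p : MvPolynomial (Fin b) ℚ) (ℓ₁ ℓ₂ : (Fin b → ℚ) × ℚ) (a : Fin k → Option ((Fin (b + 1) → ℚ) × ℚ)) (lo hi : Fin k → Fin k ⊕ ((Fin (b + 1) → ℚ) × ℚ)), (n₁ = 0 ∨ n₂ = 0) ∧ n₂ = 1 ∧ Bornology.IsBounded s.domain ∧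 s.domain = {z | (∀ j, 0 < ∑ i, ((M j).1 i : ℝ) * z (Fin.castAdd k i) + ((M j).2 : ℝ)) ∧ ∀ i, Sum.elim (fun j => z (Fin.natAdd (b + 1) j)) (fun c => ∑ i', (c.1 i' : ℝ) * z (Fin.castAdd k i') + (c.2 : ℝ)) (lo i) < z (Fin.natAdd (b + 1) i) ∧ z (Fin.natAdd (b + 1) i) < Sum.elim (fun j => z (Fin.natAdd (b + 1) j)) (fun c => ∑ i', (c.1 i' : ℝ) * z (Fin.castAdd k i') + (c.2 : ℝ)) (hi i)} ∧ EqOn s.integrand (fun z => MvPolynomial.aeval (fun i => z (Fin.castAdd k (Fin.castSucc i))) p / (∏ j, (∑ i, ((L j).1 i : ℝ) * z (Fin.castAdd k (Fin.castSucc i)) + ((L j).2 : ℝ)) ^ e j) * ((z (Fin.castAdd k (Fin.last b)) - (∑ i, (ℓ₁.1 i : ℝ) * z (Fin.castAdd k (Fin.castSucc i)) + (ℓ₁.2 : ℝ))) ^ n₁ / (z (Fin.castAdd k (Fin.last b)) - (∑ i, (ℓ₂.1 i : ℝ) * z (Fin.castAdd k (Fin.castSucc i)) + (ℓ₂.2 :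 ℝ))) ^ n₂) * ∏ i, (a i).elim 1 (fun c => 1 / (z (Fin.natAdd (b + 1) i) - (∑ i', (c.1 i' : ℝ) * z (Fin.castAdd k i') + (c.2 : ℝ))))) s.domain ∧ w = KZ.of s}) (hGG : ∀ b σ k, GG b σ k = {w : KZ.FormalRep | ∃ (m m' n₁ n₂ : ℕ) (s : KZ.IntegralRep (b + 1 + k)) (M : Fin m' → (Fin (b + 1) → ℚ) × ℚ) (L : Fin m → (Fin b → ℚ) × ℚ) (e : Fin m → ℕ) (p : MvPolynomial (Fin b) ℚ) (ℓ₁ ℓ₂ : (Fin b → ℚ) × ℚ) (a : Fin k → Option ((Fin (b + 1) → ℚ) × ℚ)) (lo hi : Fin k → Fin k ⊕ ((Fin (b + 1) → ℚ) × ℚ)), (n₁ = 0 ∨ n₂ = 0) ∧ (σ = 2 → (∀ i c, a i = some c → c.1 (Fin.last b) = 0) ∧ (∀ i c, (lo i = Sum.inr c ∨ hi i = Sum.inr c) → (c.1 (Fin.last b) = 0 ∨ c = (Pi.single (Fin.last b) 1, 0)))) ∧ Bornology.IsBounded s.domain ∧ s.domain = {z | (∀ j, 0 < ∑ i, ((M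 j).1 i : ℝ) * z (Fin.castAdd k i) + ((M j).2 : ℝ)) ∧ ∀ i, Sum.elim (fun j => z (Fin.natAdd (b + 1) j)) (fun c => ∑ i', (c.1 i' : ℝ) * z (Fin.castAdd k i') + (c.2 : ℝ)) (lo i) < z (Fin.natAdd (b + 1) i) ∧ z (Fin.natAdd (b + 1) i) < Sum.elim (fun j => z (Fin.natAdd (b + 1) j)) (fun c => ∑ i', (c.1 i' : ℝ) * z (Fin.castAdd k i') + (c.2 : ℝ)) (hi i)} ∧ EqOn s.integrand (fun z => MvPolynomial.aeval (fun i => z (Fin.castAdd k (Fin.castSucc i))) p / (∏ j, (∑ i, ((L j).1 i : ℝ) * z (Fin.castAdd k (Fin.castSucc i)) + ((L j).2 : ℝ)) ^ e j) * ((z (Fin.castAdd k (Fin.last b)) - (∑ i, (ℓ₁.1 i : ℝ) * z (Fin.castAdd k (Fin.castSucc i)) + (ℓ₁.2 : ℝ))) ^ n₁ / (z (Fin.castAdd k (Fin.last b)) - (∑ i, (ℓ₂.1 i : ℝ) * z (Fin.castAdd k (Fin.castSucc i)) + (ℓ₂.2 : ℝ))) ^ n₂) * ∏ i, (a i).elim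 1 (fun c => 1 / (z (Fin.natAdd (b + 1) i) - (∑ i', (c.1 i' : ℝ) * z (Fin.castAdd k i') + (c.2 : ℝ))))) s.domain ∧ w = KZ.of s}) (b : ℕ) (Hpar : ∀ (m : ℕ) (L : Fin m → (Fin (b + 1) → ℚ) × ℚ) (e : Fin m → ℕ) (ℓ₁ ℓ₂ : (Fin (b + 1) → ℚ) × ℚ), ∀ (m' : ℕ) (s : KZ.IntegralRep (b + 1 + 1 + 1)) (M : Fin m' → (Fin (b + 1 + 1) → ℚ) × ℚ) (p : MvPolynomial (Fin (b + 1)) ℚ) (u v : (Fin (b + 1 + 1) → ℚ) × ℚ), Bornology.IsBounded s.domain → s.domain = SeparatePos.gDom (b + 1) 1 m' M (fun _ => Sum.inr u) (fun _ => Sum.inr v) → EqOn s.integrand (RebasePos.glit (b + 1) 1 p L e ℓ₁ ℓ₂ 0 1 (fun _ => some 0)) s.domain → u.1 (Fin.last (b + 1)) ≠ 0 → u.1 (Fin.last (b + 1)) = v.1 (Fin.last (b + 1)) → (∀ z : Fin (b + 1 + 1 + 1) → ℝ, (∀ j, 0 < SeparatePos.affF (b + 1) 1 (M j) z) → 0 <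 SeparatePos.affF (b + 1) 1 u z ∧ SeparatePos.affF (b + 1) 1 u z < SeparatePos.affF (b + 1) 1 v z) → ∃ c ∈ AddSubgroup.closure (SeparatePos.GGset (b + 1) 2 1), KZ.of s - c ∈ KZ.relations) (Hthick : ∀ (m : ℕ) (L : Fin m → (Fin (b + 1) → ℚ) × ℚ) (e : Fin m → ℕ) (ℓ₁ ℓ₂ : (Fin (b + 1) → ℚ) × ℚ), ∀ (m' : ℕ) (s : KZ.IntegralRep (b + 1 + 1 + 1)) (M : Fin m' → (Fin (b + 1 + 1) → ℚ) × ℚ) (p : MvPolynomial (Fin (b + 1)) ℚ) (u v κ : (Fin (b + 1 + 1) → ℚ) × ℚ) (A : ℚ), Bornology.IsBounded s.domain → s.domain = SeparatePos.gDom (b + 1) 1 m' M (fun _ => Sum.inr u) (fun _ => Sum.inr v) → EqOn s.integrand (RebasePos.glit (b + 1) 1 p L e ℓ₁ ℓ₂ 0 1 (fun _ => some 0)) s.domain → κ.1 (Fin.last (b + 1)) = 0 → u - κ = A • (v - u) → 0 < A → (∀ z : Fin (b + 1 + 1 + 1) → ℝ, (∀ j, 0 < SeparatePos.affF (b + 1)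 1 (M j) z) → SeparatePos.affF (b + 1) 1 κ z < 0 ∧ 0 < SeparatePos.affF (b + 1) 1 u z ∧ SeparatePos.affF (b + 1) 1 u z < SeparatePos.affF (b + 1) 1 v z) → ∃ c ∈ AddSubgroup.closure (SeparatePos.GGset (b + 1) 2 1), KZ.of s - c ∈ KZ.relations) (Hfar : ∀ (m : ℕ) (L : Fin m → (Fin (b + 1) → ℚ) × ℚ) (e : Fin m → ℕ) (ℓ₁ ℓ₂ : (Fin (b + 1) → ℚ) × ℚ), ∀ (m' : ℕ) (s : KZ.IntegralRep (b + 1 + 1 + 1)) (M : Fin m' → (Fin (b + 1 + 1) → ℚ) × ℚ) (p : MvPolynomial (Fin (b + 1)) ℚ) (u v κ : (Fin (b + 1 + 1) → ℚ) × ℚ) (A : ℚ), Bornology.IsBounded s.domain → s.domain = SeparatePos.gDom (b + 1) 1 m' M (fun _ => Sum.inr u) (fun _ => Sum.inr v) → EqOn s.integrand (RebasePos.glit (b + 1) 1 p L e ℓ₁ ℓ₂ 0 1 (fun _ => some 0)) s.domain → κ.1 (Fin.last (b + 1)) = 0 → u - κ = A • (v - u) → 0 < A → (∀ z : Fin (b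 + 1 + 1 + 1) → ℝ, (∀ j, 0 < SeparatePos.affF (b + 1) 1 (M j) z) → 0 < SeparatePos.affF (b + 1) 1 κ z ∧ SeparatePos.affF (b + 1) 1 u z < SeparatePos.affF (b + 1) 1 v z ∧ 2 * SeparatePos.affF (b + 1) 1 κ z ≤ SeparatePos.affF (b + 1) 1 v z) → ∃ c ∈ AddSubgroup.closure (SeparatePos.GGset (b + 1) 2 1), KZ.of s - c ∈ KZ.relations) : ∀ x ∈ GS (b + 1) 1, ∃ c ∈ AddSubgroup.closure (GG (b + 1) 2 1), x - c ∈ KZ.relations := by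
  intro x hx
  rw [hGS] at hx
  obtain ⟨m, m', n₁, n₂, s, M, L, e, p, ℓ₁, ℓ₂, a, lo, hi, h12, hn₂, hbd, hdom, hint, rfl⟩ := hx
  obtain rfl : n₁ = 0 := h12.resolve_right (by rw [hn₂]; exact one_ne_zero)
  subst hn₂
  rw [hGG]
  exact rebaseSimplePos_oneFibre_of_residual (b + 1) m m' 0 1 s M L e p ℓ₁ ℓ₂ a lo hi (Or.inl rfl) hbd
    hdom hint (Hpar m L e ℓ₁ ℓ₂) (Hthick m L e ℓ₁ ℓ₂) (Hfar m L e ℓ₁ ℓ₂)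


end Summit.KontsevichZagierPeriods.ArrangementNormalForm.JanusBands
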